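import Summits.ABC.IUTFork.Repair.RHTameBandLicence
import HarnessLib

/-!
# R-H ROUND 2, Q3 («does genuine data always lie in Σ for l ≫ 0?») — TESTER CELLS from the negation side, rows 5 / 16 (tame cells)

Seat abc-iut-rh-tst-5 (R-H PAIR n = 5 TESTER, gen 3; round-2 tester of typ-5's Q2(5)/Q2(16)). PROOF-ONLY over abc-iut-rh-typ-5's
`RH.TameBandLicence.Cell` (p458742): no `def`, no new `Prop`, no instance. HONEST FRAMING: nothing here asserts abc proved or refuted;
no side is taken on [IUTchIII] Cor. 3.12 or on any author; H⋆ rows are hypotheses; typed ≠ proved.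

THE DICHOTOMY (integer bookkeeping, uniform in `l`). At a bad place `w ∣ v ∣ p` of the genuine `K`-line datum write `e_v := e(F_v/ℚ_p)`,
`e(K_w/F_v) = 2j+1 = l` at the TOP label `j = l⋆`, so `e_w = e_v·(2j+1)`, and `2·P_w = e_v·H` with `H := ord_v(q_v)/1` in `ℚ_p`-normalised
units (`2l·P_w = e(w|v)·ord_v(q_v)`, [IUTchI] Ex. 3.2 (iv); on the HEX λ_k line `H = 2k`, on Frey data `H = ord_p Δ`). Then for EVERY `j ≥ 7`
(i.e. every prime `l ≥ 17`):
* `H ≤ 4` ⟹ the row-5 cell `(j²−1)P ≤ j(e−1) + (j²P−1) mod e` HOLDS (already by its band-top half `(j²−1)P ≤ j(e−1)`, which is ALSO the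
  row-16 cell `RH.DiffPriced.Cell` on `p ∤ e_w`, tame different `e·d = e − 1`; rows 8/15 carry an extra shell-radius term `r♯` and are NOT
  covered here) — `cell_of_two_mul_le`, `cell_topLabel_of_H_le_four`;
* `H ≥ 5` ⟹ the cell FAILS (already its linear shadow `(j−1)P ≤ e−1` fails) — `not_cell_of_five_mul_le`, `not_cell_topLabel_of_five_le_H`;
* hence `Cell e P j ↔ H ≤ 4` (`cell_topLabel_iff_H_le_four`): membership of a tame packet in Σ at the top label is decided by `H ≤ 4`
  INDEPENDENTLY of `l ≥ 17`. In WINDOW-TABLE column vocabulary (`μ = m_q/e_w`, col 19): cell ⟺ `l·μ ≤ 2`; table check v4.13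
  09f7e066b0e33de1: 1710/1710 top-label packet rows with `l⋆ ≥ 7` obey it (HEX 570, FREY 1140; 0 disagreements), 954/979 at `l⋆ < 7`
  (the 25 small-`l` rows are cell-POS with `l·μ > 2`, as the NEG leg needs `j ≥ 7`). So «genuine data ∈ Σ for l ≫ 0» is FALSE as a universal statement: a datum with one tame bad place of
  `H ≥ 5` is OFF Σ at every prime `l ≥ 17`; a datum all of whose tame bad places have `H ≤ 4` is IN Σ at every `l` — Σ stabilises to the
  bounded-exponent family `H ≤ 4` (HEX: `k ≤ 2`, the signed slice of row 16; Frey: `ord_p(abc) ≤ 2` at the tame bad primes), it does not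
  grow with `l`. If `e(K_w/F_v) = c·l` both `e_w` and `P_w` scale by `c` and the same dichotomy holds with `e_v` replaced by `c·e_v`.
Kernel spot-checks against rows of record: `k1_rows_topLabel` (typ-5's `k1_cells_frey_sample` triples and WINDOW-TABLE HEX top-label
triples, each tagged with its `H`).
[cite: Mochizuki2012, IUTchI Ex. 3.2 (iv) p. 71; IUTchIV Prop. 1.2 (i)(ii) p. 10] [claim: Mochizuki2012, status: disputed]
-/

namespace Summit.ABC.IUTFork.Repair.RH.TameBandLicence

/-! ## §1. Generic cells: the band-top window `P ≤ 2·e_v` and the linear wall `2·P ≥ 5·e_v` -/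

/-- **POS side, uniform in the label.** If `P ≤ 2·e_v` and `e ≥ e_v·(2j+1)` then the row-5 cell holds at label `j ≥ 1`
(via its band-top half `(j²−1)P ≤ j(e−1)`). [folklore] -/
theorem cell_of_two_mul_le {ev e P j : ℤ} (hev : 1 ≤ ev) (hP : P ≤ 2 * ev) (hj : 1 ≤ j)
    (he : ev * (2 * j + 1) ≤ e) : Cell e P j := by
  refine cell_of_bandTop (by nlinarith) ?_
  have h1 : 0 ≤ (j ^ 2 - 1) * (2 * ev - P) := mul_nonneg (by nlinarith) (by omega)
  have h2 : 0 ≤ j * (e - ev * (2 * j + 1)) := mul_nonneg (by omega) (by omega)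
  have h3 : 0 ≤ j * (ev - 1) := mul_nonneg (by omega) (by omega)
  nlinarith [h1, h2, h3]

/-- **NEG side, uniform in the label `j ≥ 7`.** If `2·P ≥ 5·e_v` and `e ≤ e_v·(2j+1)` then the row-5 cell fails at every label
`j ≥ 7` (its linear shadow `(j−1)P ≤ e−1` already fails). [folklore] -/
theorem not_cell_of_five_mul_le {ev e P j : ℤ} (hev : 1 ≤ ev) (hP : 5 * ev ≤ 2 * P) (he1 : 1 ≤ e)
    (he : e ≤ ev * (2 * j + 1)) (hj : 7 ≤ j) : ¬ Cell e P j := by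
  intro h
  have hlin := linear_of_cell he1 (by omega) h
  have h1 : 5 * ev * (j - 1) ≤ 2 * ((j - 1) * P) := by nlinarith
  nlinarith [hlin, h1, he, hj, hev]

/-- The linear wall alone: `e − 1 < (j−1)·P` refutes the cell (`linear_of_cell`). [folklore] -/
theorem not_cell_of_linear_lt {e P j : ℤ} (he1 : 1 ≤ e) (hj : 1 ≤ j) (h : e - 1 < (j - 1) * P) : ¬ Cell e P j :=
  fun hc => absurd (linear_of_cell he1 hj hc) (not_le.2 h)

/-! ## §2. The `H`-dichotomy at the top label (`e = e_v·(2j+1)`, `2P = e_v·H`) -/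

/-- `H ≤ 4` ⟹ IN Σ at every label `j ≥ 1` (any `l`). [folklore] -/
theorem cell_topLabel_of_H_le_four {ev e P H j : ℤ} (hev : 1 ≤ ev) (hH : H ≤ 4) (hP : 2 * P = ev * H)
    (hj : 1 ≤ j) (he : e = ev * (2 * j + 1)) : Cell e P j :=
  cell_of_two_mul_le hev (by nlinarith) hj he.symm.le

/-- `H ≥ 5` ⟹ OFF Σ at every top label `j = l⋆ ≥ 7`, i.e. every prime `l ≥ 17`. [folklore] -/
theorem not_cell_topLabel_of_five_le_H {ev e P H j : ℤ} (hev : 1 ≤ ev) (hH : 5 ≤ H) (hP : 2 * P = ev * H)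
    (he : e = ev * (2 * j + 1)) (hj : 7 ≤ j) : ¬ Cell e P j :=
  not_cell_of_five_mul_le hev (by nlinarith) (by nlinarith) he.le hj

/-- **THE DICHOTOMY.** At the top label `j = l⋆ ≥ 7` of a tame packet with `e_w = e_v·l`, `2P_w = e_v·H`: the cell holds IFF `H ≤ 4` (any integer `H`) —
independently of `l`. [folklore] -/
theorem cell_topLabel_iff_H_le_four {ev e P H j : ℤ} (hev : 1 ≤ ev) (hP : 2 * P = ev * H)
    (he : e = ev * (2 * j + 1)) (hj : 7 ≤ j) : Cell e P j ↔ H ≤ 4 := by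
  constructor
  · intro h
    by_contra hH
    exact not_cell_topLabel_of_five_le_H hev (by omega) hP he hj h
  · intro hH
    exact cell_topLabel_of_H_le_four hev hH hP (by omega) he

/-- With `e(K_w/F_v) = c·l` (`c ≥ 1`) both `e_w` and `P_w` scale by `c`; the dichotomy is unchanged (`e_v ↦ c·e_v`). [folklore] -/
theorem cell_topLabel_iff_H_le_four_mul {ev c e P H j : ℤ} (hev : 1 ≤ ev) (hc : 1 ≤ c)
    (hP : 2 * P = c * ev * H) (he : e = c * ev * (2 * j + 1)) (hj : 7 ≤ j) : Cell e P j ↔ H ≤ 4 :=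
  cell_topLabel_iff_H_le_four (ev := c * ev) (by nlinarith) hP he hj

/-! ## §3. Kernel spot-checks at rows of record (top label), each with its `H` -/

/-- typ-5's `k1_cells_frey_sample` triples re-read through the dichotomy: `(1605,15,53)` `e_v = 15`, `H = 2` HOLD; `(165,15,5)` `H = 2`
HOLD (`j = 5 < 7`, holds anyway); `(1545,30,51)` `e_v = 15`, `H = 4` HOLD; `(115,15,11)` `e_v = 5`, `H = 6` FAIL; `(321,15,53)` `e_v = 3`,
`H = 10` FAIL; `(65,45,6)` `e_v = 5`, `H = 18` FAIL (`j = 6 < 7`, fails anyway). WINDOW-TABLE HEX top-label triples (`e_w = e_v·l`,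
`P = m_q = k·e_v`, `H = 2k`): G-HEX-k1-l17-ev15 `(255,15,8)` HOLD, G-HEX-k2-l17-ev15 `(255,30,8)` HOLD, G-HEX-k3-l17-ev5 `(85,15,8)` FAIL,
G-HEX-k4-l17-ev15 `(255,60,8)` FAIL, G-HEX-k2-l37-ev15 `(555,30,18)` HOLD, G-HEX-k3-l37-ev5 `(185,15,18)` FAIL. [folklore] -/
theorem k1_rows_topLabel :
    Cell 1605 15 53 ∧ Cell 165 15 5 ∧ Cell 1545 30 51 ∧ ¬ Cell 115 15 11 ∧ ¬ Cell 321 15 53 ∧ ¬ Cell 65 45 6 ∧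
      Cell 255 15 8 ∧ Cell 255 30 8 ∧ ¬ Cell 85 15 8 ∧ ¬ Cell 255 60 8 ∧ Cell 555 30 18 ∧ ¬ Cell 185 15 18 := by
  simp only [Cell]
  decide

end Summit.ABC.IUTFork.Repair.RH.TameBandLicence
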